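import Summits.Ventures.CertifiedManyBodySolver.Observables.KineticWordD4
import HarnessLib

/-!
# Ventures/CertifiedManyBodySolver — Observables/DiagKineticWordD4.lean

HONEST FRAMING: first certified bounds; not a superconductivity verdict; every number certified or labelled float.
(cell hubbard-algo, seat hubbard-box-eng-3 g4; theorem-only support for typing the `hop2` (next-nearest-neighbour hopping) BOX WORDS of
the box-dual product `boxdual/0` as `D₄`-orbit rows — `BOXDUAL-FORMAT.md` §17; zero compute, no certificate, no named fact, no `sorry`.)

**The `D₄`-ORBIT reading of the DIAGONAL KINETIC WORD** — the `t'`-companion of `Observables/KineticWordD4.lean` (obs-lit g2), cloned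
bond for bond with the nearest-neighbour steps `e₁, e₂` replaced by the diagonal steps `d₁ = e₁ + e₂ = (1,1)`, `d₂ = e₂ − e₁ = (−1,1)`.
The NNN hopping letter `y₄` of the fsdrive `3x3 b2bd4-e4+pair` family (HOP2 = 8·y₄; energy row `−8y₂ − 8t'y₄ + U y₇`) is the class
representative of `Re ω(c†_{0σ} c_{dσ})` over translations × `D₄` × spin flip × adjoint; the word
`k̂_diag = −2 Σ_{s ∈ {1,2}} Σ_σ c†_{0σ} c_{d_sσ}` read in the G-averaged state is `−HOP2`. This file proves, for EVERY TRANSLATION-INVARIANT `ω`,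
`|D₄|⁻¹ Σ_γ Re ω_{γW}(Γ(d4Emb γ 0 W) k̂_diag) = k_diag(ω) := Σ_s (−1)·Σ_σ (Re ω(c†_{0σ}c_{d_sσ}) + Re ω(c†_{d_sσ}c_{0σ}))`
(`re_orbitMean_diagKinWord_eq_diagKineticDensity`): (1) transport of one diagonal hopping word under `Γ(d4Emb γ 0)`
(`re_expect_d4Emb_diagHopWord`); (2) the orbit of `d₁` (and of `d₂`) runs through the four diagonals twice (`d4_sum_d1/d3`,
Transport/D4VecAction.lean); (3) translation invariance + Hermiticity flip `−d ↦ d` (`re_expect_hop_neg`, KineticWordD4); (4) Hermiticity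
on a bond (`re_expect_hop_swap`). CONSEQUENCE for box rows (`Rows/DopedTLCorrBox.lean`): an orbit LOWER box row `−w ≤ orbit mean` on `k̂_diag`
is the box word `HOP2 ≤ w`, and on `−k̂_diag` with slot `w` the word `HOP2 ≥ w` (`boxdual.leannodes --edge hop2±`).
References: Scalapino–White–Zhang, PRB 47 (1993) 7995, §II [ScalapinoWhiteZhang1993]; Bratteli–Robinson II §6.2.4 [BratteliRobinsonII1997].
-/

noncomputable section

namespace Summit.Ventures.CertifiedManyBodySolver.Observables

open Literature.MathematicalPhysics.QuantumLattice
open Literature.MathematicalPhysics.QuantumLattice.ThermodynamicLimit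
open Literature.Probability.LatticeModels
open Summit.Ventures.CertifiedManyBodySolver.Transport
open Matrix Finset Filter Topology HubbardWave0
open scoped Matrix BigOperators ComplexOrder

/-! ## §0 The diagonal window and the diagonal kinetic word -/

/-- The two diagonal steps `d₁ = (1,1)`, `d₂ = (−1,1)` (one per diagonal bond class through the origin). [cite: ScalapinoWhiteZhang1993, §II] -/
abbrev diagVec (s : Fin 2) : Site 2 := ![(![1, 1] : Site 2), ![-1, 1]] s

/-- `d₁ = (1,1)`. [folklore] -/
theorem diagVec_zero : diagVec 0 = ![1, 1] := rfl

/-- `d₂ = (−1,1)`. [folklore] -/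
theorem diagVec_one : diagVec 1 = ![-1, 1] := rfl

/-- The diagonal window `W' = {0, d₁, d₂}` (the support of the `hop2` objective's word). [cite: ScalapinoWhiteZhang1993, §II] -/
abbrev diagWindow : Finset (Site 2) := {0, diagVec 0, diagVec 1}

/-- `0 ∈ W'`. [folklore] -/
theorem zero_mem_diagWindow : (0 : Site 2) ∈ diagWindow := mem_insert_self _ _

/-- `d_s ∈ W'`. [folklore] -/
theorem diagVec_mem_diagWindow (s : Fin 2) : diagVec s ∈ diagWindow := by
  fin_cases s
  · exact mem_insert_of_mem (mem_insert_self _ _)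
  · exact mem_insert_of_mem (mem_insert_of_mem (mem_singleton_self _))

/-- One diagonal hopping word `c†_{0σ} c_{d_sσ} ∈ 𝔄_{W'}`. [cite: ScalapinoWhiteZhang1993, §II] -/
abbrev diagHopWord (s σ : Fin 2) : FermionOp diagWindow :=
  (cAt 0 zero_mem_diagWindow σ)ᴴ * cAt (diagVec s) (diagVec_mem_diagWindow s) σ

/-- **The diagonal kinetic word** `k̂_diag = −2 Σ_{s,σ} c†_{0σ} c_{d_sσ}` (`t' = 1` normalisation; the fsdrive letter reads
`HOP2 = −(orbit mean of k̂_diag)`). [cite: ScalapinoWhiteZhang1993, §II] -/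
abbrev diagKinWord : FermionOp diagWindow :=
  (-2 : ℂ) • ∑ s : Fin 2, ∑ σ : Fin 2, diagHopWord s σ

/-! ## §1 One diagonal hopping word under `D₄` transport -/

/-- Transport of one diagonal hopping word: `Re ω_{γW'}(Γ_γ(c†_{0σ}c_{d_sσ})) = Re ω_{{0,γd_s}}(c†_{0σ} c_{γd_s,σ})`
(`Γ(d4Emb) c_{xσ} = c_{γx,σ}`, isotony). [cite: BratteliRobinsonII1997, §6.2.4] -/
theorem re_expect_d4Emb_diagHopWord (ω : InfVolFermionState 2) (γ : DihedralGroup 4) (s σ : Fin 2) :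
    (ω.expect (d4ShiftSet γ 0 diagWindow) (fermionEmbed (PolySite.d4Emb γ 0 diagWindow) (diagHopWord s σ))).re =
      (ω.expect ({0, d4Vec γ (diagVec s)} : Finset (Site 2))
        ((cAt 0 (mem_insert_self _ _) σ)ᴴ * cAt (d4Vec γ (diagVec s)) (mem_insert_of_mem (mem_singleton_self _)) σ)).re := by
  have h0 : d4Vec γ (0 : Site 2) + 0 = 0 := by rw [add_zero, (d4Vec_eq_zero_iff γ 0).2 rfl]
  have hv : d4Vec γ (diagVec s) + 0 = d4Vec γ (diagVec s) := add_zero _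
  have hsub : ({0, d4Vec γ (diagVec s)} : Finset (Site 2)) ⊆ d4ShiftSet γ 0 diagWindow := by
    intro z hz
    rcases mem_insert.1 hz with rfl | hz
    · have h := d4Vec_add_mem_d4ShiftSet γ 0 zero_mem_diagWindow
      rwa [h0] at h
    · rw [mem_singleton.1 hz]
      have h := d4Vec_add_mem_d4ShiftSet γ 0 (diagVec_mem_diagWindow s)
      rwa [hv] at h
  have h1 : fermionEmbed (PolySite.d4Emb γ 0 diagWindow) (cAt 0 zero_mem_diagWindow σ) = cAt 0 (hsub (mem_insert_self _ _)) σ :=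
    (fermionEmbed_annihilation _ _ _).trans (cAt_congr (d4Vec_add_mem_d4ShiftSet γ 0 zero_mem_diagWindow) _ h0 σ)
  have h2 : fermionEmbed (PolySite.d4Emb γ 0 diagWindow) (cAt (diagVec s) (diagVec_mem_diagWindow s) σ) =
      cAt (d4Vec γ (diagVec s)) (hsub (mem_insert_of_mem (mem_singleton_self _))) σ :=
    (fermionEmbed_annihilation _ _ _).trans (cAt_congr (d4Vec_add_mem_d4ShiftSet γ 0 (diagVec_mem_diagWindow s)) _ hv σ)
  have hw : fermionEmbed (PolySite.d4Emb γ 0 diagWindow) (diagHopWord s σ) =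
      fermionEmbed (PolySite.incl hsub)
        ((cAt 0 (mem_insert_self _ _) σ)ᴴ * cAt (d4Vec γ (diagVec s)) (mem_insert_of_mem (mem_singleton_self _)) σ) := by
    rw [map_mul, map_mul, fermionEmbed_conjTranspose, fermionEmbed_conjTranspose, fermionEmbed_incl_cAt, fermionEmbed_incl_cAt, h1, h2]
  rw [hw, ω.compatible hsub]

/-! ## §2 The orbit mean of the diagonal kinetic word is the diagonal kinetic energy density -/

/-- **Orbit sum of one diagonal hopping word** (translation-invariant `ω`):
`Σ_γ Re ω_{γW'}(Γ_γ (c†_{0σ}c_{d_sσ})) = 4·(Re ω(c†_{0σ}c_{d₁σ}) + Re ω(c†_{0σ}c_{d₂σ}))` (the orbit of `d_s` is the four diagonals, each twice;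
the bonds `−d` are flipped by translation invariance). [cite: ScalapinoWhiteZhang1993, §II] -/
theorem sum_re_expect_d4Emb_diagHopWord {ω : InfVolFermionState 2} (hω : ω.IsTranslationInvariant) (s σ : Fin 2) :
    ∑ γ : DihedralGroup 4, (ω.expect (d4ShiftSet γ 0 diagWindow) (fermionEmbed (PolySite.d4Emb γ 0 diagWindow) (diagHopWord s σ))).re =
      4 * ((ω.expect ({0, diagVec 0} : Finset (Site 2))
              ((cAt 0 (mem_insert_self _ _) σ)ᴴ * cAt (diagVec 0) (mem_insert_of_mem (mem_singleton_self _)) σ)).re +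
           (ω.expect ({0, diagVec 1} : Finset (Site 2))
              ((cAt 0 (mem_insert_self _ _) σ)ᴴ * cAt (diagVec 1) (mem_insert_of_mem (mem_singleton_self _)) σ)).re) := by
  simp_rw [re_expect_d4Emb_diagHopWord]
  set F : Site 2 → ℝ := fun v => (ω.expect ({0, v} : Finset (Site 2))
      ((cAt 0 (mem_insert_self _ _) σ)ᴴ * cAt v (mem_insert_of_mem (mem_singleton_self _)) σ)).re with hF
  have hsum : ∑ γ : DihedralGroup 4, F (d4Vec γ (diagVec s)) = 2 * (F ![1, 1] + F ![-1, -1] + F ![-1, 1] + F ![1, -1]) := by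
    have hs : s = 0 ∨ s = 1 := by fin_cases s <;> simp
    rcases hs with rfl | rfl
    · rw [diagVec_zero]; exact d4_sum_d1 F
    · rw [diagVec_one]; exact d4_sum_d3 F
  have hn1 : (![-1, -1] : Site 2) = -![1, 1] := by decide
  have hn2 : (![1, -1] : Site 2) = -![-1, 1] := by decide
  have hflip1 : F ![-1, -1] = F ![1, 1] := by simp only [hF]; rw [hn1]; exact re_expect_hop_neg hω _ σ
  have hflip2 : F ![1, -1] = F ![-1, 1] := by simp only [hF]; rw [hn2]; exact re_expect_hop_neg hω _ σ
  simp only [hF] at hsum hflip1 hflip2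
  rw [hsum, hflip1, hflip2, diagVec_zero, diagVec_one]
  ring

/-- **The `D₄`-orbit mean of the diagonal kinetic word is the diagonal kinetic energy density** (translation-invariant `ω`; `|D₄| = 8`):
`|D₄|⁻¹ Σ_γ Re ω_{γW'}(Γ(d4Emb γ 0 W') k̂_diag) = Σ_s (−1)·Σ_σ (Re ω(c†_{0σ}c_{d_sσ}) + Re ω(c†_{d_sσ}c_{0σ}))` — the bond form (t' = 1) of the
next-nearest-neighbour kinetic energy per site; the fsdrive letter HOP2 is its negative. [cite: ScalapinoWhiteZhang1993, §II] -/
theorem re_orbitMean_diagKinWord_eq_diagKineticDensity {ω : InfVolFermionState 2} (hω : ω.IsTranslationInvariant) :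
    ((Finset.univ : Finset (DihedralGroup 4)).card : ℝ)⁻¹ *
        ∑ γ ∈ (Finset.univ : Finset (DihedralGroup 4)),
          (ω.expect (d4ShiftSet γ 0 diagWindow) (fermionEmbed (PolySite.d4Emb γ 0 diagWindow) diagKinWord)).re =
      ∑ s : Fin 2, -(1 : ℝ) * ∑ σ : Fin 2,
        ((ω.expect ({0, diagVec s} : Finset (Site 2))
            ((cAt 0 (mem_insert_self _ _) σ)ᴴ * cAt (diagVec s) (mem_insert_of_mem (mem_singleton_self _)) σ)).re +
          (ω.expect ({0, diagVec s} : Finset (Site 2))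
            ((cAt (diagVec s) (mem_insert_of_mem (mem_singleton_self _)) σ)ᴴ * cAt 0 (mem_insert_self _ _) σ)).re) := by
  have hcard : ((Finset.univ : Finset (DihedralGroup 4)).card : ℝ) = 8 := by
    rw [Finset.card_univ]; exact_mod_cast (by decide : Fintype.card (DihedralGroup 4) = 8)
  have hexp : ∀ γ : DihedralGroup 4,
      (ω.expect (d4ShiftSet γ 0 diagWindow) (fermionEmbed (PolySite.d4Emb γ 0 diagWindow) diagKinWord)).re =
        -2 * ∑ s : Fin 2, ∑ σ : Fin 2,
          (ω.expect (d4ShiftSet γ 0 diagWindow) (fermionEmbed (PolySite.d4Emb γ 0 diagWindow) (diagHopWord s σ))).re := by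
    intro γ
    rw [show (diagKinWord : FermionOp diagWindow) = (-2 : ℂ) • ∑ s : Fin 2, ∑ σ : Fin 2, diagHopWord s σ from rfl,
      fermionEmbed_smul, map_smul, smul_eq_mul, show (-2 : ℂ) = ((-2 : ℝ) : ℂ) by norm_num, Complex.re_ofReal_mul,
      map_sum, map_sum, Complex.re_sum]
    congr 1
    refine Finset.sum_congr rfl fun s _ => ?_
    rw [map_sum, map_sum, Complex.re_sum]
  simp_rw [hexp]
  rw [hcard, ← Finset.mul_sum, Finset.sum_comm]
  simp_rw [Finset.sum_comm (s := (Finset.univ : Finset (DihedralGroup 4))) (t := (Finset.univ : Finset (Fin 2))),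
    sum_re_expect_d4Emb_diagHopWord hω]
  simp_rw [re_expect_hop_swap]
  simp only [Fin.sum_univ_two, diagVec_zero, diagVec_one]
  ring

/-! ## §3 Reconciliation with the tree's diagonal jump vectors (`HubbardNNNHoppingInteraction.diagVec`: `e₁ + e₂`, `e₁ − e₂`) -/

/-- `d₁` IS the tree's first diagonal jump vector `e₁ + e₂`. [folklore] -/
theorem diagVec_zero_eq_quantumLattice_diagVec :
    Observables.diagVec 0 = Literature.MathematicalPhysics.QuantumLattice.diagVec 0 := by
  ext i; fin_cases i <;> simp [Literature.MathematicalPhysics.QuantumLattice.diagVec, Observables.diagVec]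

/-- `d₂ = (−1,1)` is MINUS the tree's second diagonal jump vector `e₁ − e₂` (the same bond read backwards; for translation-invariant states the
hopping expectation is unchanged, `re_expect_hop_neg`). [folklore] -/
theorem diagVec_one_eq_neg_quantumLattice_diagVec :
    Observables.diagVec 1 = -Literature.MathematicalPhysics.QuantumLattice.diagVec 1 := by
  ext i; fin_cases i <;> simp [Literature.MathematicalPhysics.QuantumLattice.diagVec, Observables.diagVec]

end Summit.Ventures.CertifiedManyBodySolver.Observables

end
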